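import Summits.AtomisticToContinuum.Crystallization.Theorems.ExcessDecayLiouvilleFineGrainsSelfCertify
import Summits.AtomisticToContinuum.Crystallization.Theorems.ExcessDecayLiouvilleLimitGlue
import Summits.AtomisticToContinuum.Crystallization.Theorems.FineGrains.Negative.LoadBearing

/-!
# Line `Sketch` (crux `FineGrains`, stmt-AtomisticToContinuum-9330): periodic minimiser

Stub `stub_fineGrainsGivesPeriodicMin` of the line skeleton `Sketch` (card `self-certifying-grains`,
by-product (B)): `FineGrains → CrysPeriodicMinAttained` (item stmt-AtomisticToContinuum-0627) — if
every large Lennard-Jones ground state contains, for every `(ρ, ε)`, a closed ball `B_ρ(c)` two-way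
`ε`-matched with an admissible affine hcp two-lattice, then the infimum of the energy per particle
over periodic configurations of `ℝ³` is attained.

Proof.  By the landed self-certifying estimate (`stub_selfCertify`,
`energyPerParticle_le_eStar_of_charts`: `e(P) ≤ e* ≤ e(Q)`) it suffices to produce ONE periodic
configuration `P∞` which appears, for every radius `R`, every tolerance `ε` and frequently in the
particle number `N`, as an origin-based two-way `ε`-fine `R`-chart at a particle of a ground
state.  This is a diagonal compactness argument modelled on `limitGlue_proof` (item 9337):

* for `k : ℕ` apply `FineGrains` at `(ρ, ε) = (k + 3, 1/(k+1))`, take a ground state `x_k` of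
  `N_k ≥ max(N₀(k), k)` particles (`LennardJonesGroundStatesExist_holds`) and its fine-ball datum
  `(c_k, t_k, A_k)`, normalised so that both sublattice origins are within `11/10` of `c_k`
  (`near_normalise`); the converse matching at the site `t_k 0` gives a PARTICLE `p_k = x_k i_k`
  within `1` of `t_k 0`, and relative to `p_k` the datum `(τ_k, A_k)`, `τ_k m = t_k m − p_k`, is
  bounded (`‖τ_k m‖ ≤ 4`, `‖A_k‖ ≤ 0.995`) and two-way `1/(k+1)`-matches the particles within `k`
  of `p_k`;
* Bolzano–Weierstrass in `(E →L E) × (Fin 2 → E)`: along `ψ`, `A_{ψ j} → A₀`, `τ_{ψ j} → τ₀`;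
  admissible cells are uniformly bounded below (`adm_le_norm`), so `A₀` is bounded below
  (`lower_of_tendsto`), hence invertible, `A₀ Λ` is a full-rank discrete lattice
  (`ZLattice.comap`, `mem_periodLattice_iff`) and `exists_periodicConfiguration_two` gives `P∞`
  with `P∞.points = {τ₀ m + A₀ z}` (collapsed motif allowed: `FineGrains` has no `Inner`);
* charts: for `R, ε, N₀` take `j` large (`ψ j ≥ N₀`, `ψ j ≥ R + 1`, `1/(ψ j + 1) ≤ ε/2`, data
  `ε/4`-close on the `(R+1)`-ball via `dist_sites_le`); the fine ball of `x_{ψ j}` then is the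
  required chart at `p_{ψ j}` with the IDENTITY isometry, by two triangle inequalities.

All `[folklore]` (Blanc–Lewin 2015 §2.1 bookkeeping).
-/

noncomputable section

namespace Summit.AtomisticToContinuum.Crystallization.Theorems.ExcessDecayLiouvilleFineGrains

open Literature.MathematicalPhysics.StatisticalMechanics
open Summit.AtomisticToContinuum.Crystallization.Theorems.CoarseGrains.Negative.PredicateAPI
open Summit.AtomisticToContinuum.Crystallization.Theorems.FineGrains.Negative.LoadBearing
open Summit.AtomisticToContinuum.Crystallization.Theorems.ExcessDecayLiouvilleLimitGlue
open Summit.AtomisticToContinuum.Crystallization.Theses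
open Filter Topology Metric

/-- **One limit two-lattice charts all scales** (diagonal compactness; Blanc–Lewin 2015 §2.1
bookkeeping).  Under `FineGrains` there is a periodic configuration `P∞` of `ℝ³` (an affine
two-lattice `{τ₀ m + A₀ z}`) such that for every `R, ε > 0` and frequently in `N` some
Lennard-Jones ground state of `N` particles carries, at one of its particles `x i`, an
origin-based two-way `ε`-fine `R`-chart of `P∞` (with the identity isometry). [folklore] -/
theorem exists_periodic_charts_of_fineGrains (hFG : ExcessDecayLiouville.FineGrains) :
    ∃ P : PeriodicConfiguration 3,
      ∀ R ε : ℝ, 0 < R → 0 < ε → ∀ N₀ : ℕ, ∃ N : ℕ, N₀ ≤ N ∧ ∃ x : Fin N → E3,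
        IsGroundState lennardJones x ∧ ∃ (i : Fin N) (A : E3 →ₗᵢ[ℝ] E3),
          (∀ p ∈ P.points, ‖p‖ ≤ R → ∃ j : Fin N, dist (x j) (x i + A p) ≤ ε) ∧
          (∀ j : Fin N, dist (x j) (x i) ≤ R → ∃ p ∈ P.points, dist (x j) (x i + A p) ≤ ε) := by
  rw [fineGrains_iff] at hFG
  -- the period lattice `Λ` as a `ZSpan`
  have hH : (2 * Real.sqrt (2 / 3) : ℝ) ≠ 0 := by positivity
  set L := barlowPeriodLattice (fun _ => (0 : ℤ)) (one_ne_zero : (1 : ℝ) ≠ 0) hH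
    (one_ne_zero : (1 : ℕ) ≠ 0) with hLdef
  set b := barlowPeriodBasis (fun _ => (0 : ℤ)) (one_ne_zero : (1 : ℝ) ≠ 0) hH
    (one_ne_zero : (1 : ℕ) ≠ 0) with hbdef
  have hLb : L = Submodule.span ℤ (Set.range b) := rfl
  haveI : DiscreteTopology L := by rw [hLb]; infer_instance
  haveI : IsZLattice ℝ L := (inferInstance : IsZLattice ℝ (Submodule.span ℤ (Set.range b)))
  have hΛ : ∀ z : E3, z ∈ Lam ↔ z ∈ L := fun z => by
    rw [hLdef, mem_periodLattice_iff]; exact Iff.rfl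
  -- Step 1: for every `k`, a ground state of `N ≥ k` particles with a fine ball of radius `k + 3`
  -- and tolerance `1/(k+1)`, normalised and recentred at a particle `x i` within `1` of `t 0`
  have key : ∀ k : ℕ, ∃ N : ℕ, k ≤ N ∧ ∃ x : Fin N → E3, IsGroundState lennardJones x ∧
      ∃ (i : Fin N) (τ : Fin 2 → E3) (A : E3 →L[ℝ] E3), Adm A ∧ (∀ m, ‖τ m‖ ≤ 4) ∧
      (∀ j : Fin N, dist (x j) (x i) ≤ k →
        ∃ m : Fin 2, ∃ z ∈ L, dist (x j) (x i + (τ m + A z)) ≤ 1 / ((k : ℝ) + 1)) ∧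
      (∀ m : Fin 2, ∀ z ∈ L, ‖τ m + A z‖ ≤ k →
        ∃ j : Fin N, dist (x j) (x i + (τ m + A z)) ≤ 1 / ((k : ℝ) + 1)) := by
    intro k
    have hk0 : (0 : ℝ) ≤ k := Nat.cast_nonneg k
    obtain ⟨N₀, hN₀⟩ := hFG ((k : ℝ) + 3) (1 / ((k : ℝ) + 1)) (by positivity) (by positivity)
    obtain ⟨x, hx⟩ := LennardJonesGroundStatesExist_holds (max N₀ k)
    obtain ⟨c, t₁, A, hA, hN₁⟩ := hN₀ _ (le_max_left _ _) x hx
    obtain ⟨t, htc, hN⟩ := near_normalise hA hN₁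
    have hk1 : 1 / ((k : ℝ) + 1) ≤ 1 := by
      rw [div_le_one (by positivity)]; linarith
    obtain ⟨p, ⟨i, rfl⟩, hpi⟩ := hN.2 0 0 zero_mem_lam (by
      rw [map_zero, add_zero]; linarith [htc 0])
    rw [map_zero, add_zero] at hpi
    have hic : dist (x i) c ≤ 21 / 10 := by
      linarith [dist_triangle (x i) (t 0) c, htc 0]
    have hid : ∀ (m : Fin 2) (z : E3), x i + (t m - x i + A z) = t m + A z := fun m z => by abel
    refine ⟨max N₀ k, le_max_right _ _, x, hx, i, fun m => t m - x i, A, hA, fun m => ?_,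
      fun j hj => ?_, fun m z hz hmz => ?_⟩
    · rw [← dist_eq_norm]
      linarith [dist_triangle (t m) c (x i), htc m, dist_comm c (x i)]
    · have hjc : dist (x j) c ≤ (k : ℝ) + 3 := by linarith [dist_triangle (x j) (x i) c]
      obtain ⟨m, z, hz, hd⟩ := hN.1 _ (Set.mem_range_self j) hjc
      exact ⟨m, z, (hΛ z).1 hz, by rw [hid]; exact hd⟩
    · have hzc : dist (t m + A z) c ≤ (k : ℝ) + 3 := by
        have h1 : dist (t m + A z) (x i) = ‖t m - x i + A z‖ := by
          rw [dist_eq_norm]; congr 1; abel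
        linarith [dist_triangle (t m + A z) (x i) c]
      obtain ⟨p, ⟨j, rfl⟩, hd⟩ := hN.2 m z ((hΛ z).2 hz) hzc
      exact ⟨j, by rw [hid]; exact hd⟩
  choose Nk hNk x hx i τ A hAdm hτ hNear₁ hNear₂ using key
  -- bounds on the cells `A k`
  have hlow : ∀ k v, (189 / 200 : ℝ) * ‖v‖ ≤ ‖A k v‖ := fun k v => adm_le_norm (hAdm k) v
  have hup : ∀ k, ‖A k‖ ≤ 199 / 200 := fun k => (hAdm k).elim fun R hR => adm_upper hR
  have inj_of_low : ∀ B : E3 →L[ℝ] E3, (∀ v, (189 / 200 : ℝ) * ‖v‖ ≤ ‖B v‖) →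
      Function.Injective B := fun B hB v v' hvv' => by
    by_contra hne
    have h1 := hB (v - v')
    rw [map_sub, hvv', sub_self, norm_zero] at h1
    have : 0 < ‖v - v'‖ := norm_pos_iff.2 (sub_ne_zero.2 hne)
    linarith
  -- Step 2: Bolzano–Weierstrass in `(E →L E) × (Fin 2 → E)`
  set w := fun k => (A k, τ k) with hwdef
  have hbdd : Bornology.IsBounded (Set.range w) := by
    refine isBounded_iff_forall_norm_le.2 ⟨4, ?_⟩
    rintro _ ⟨k, rfl⟩
    rw [hwdef, Prod.norm_def]
    exact max_le ((hup k).trans (by norm_num))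
      ((pi_norm_le_iff_of_nonneg (by norm_num)).2 fun m => hτ k m)
  obtain ⟨⟨A₀, τ₀⟩, -, ψ, hψ, hlim⟩ :=
    tendsto_subseq_of_bounded hbdd fun k => Set.mem_range_self k
  have hA₀ : Tendsto (fun j => A (ψ j)) atTop (𝓝 A₀) := hlim.fst_nhds
  have hτ₀ : Tendsto (fun j => τ (ψ j)) atTop (𝓝 τ₀) := hlim.snd_nhds
  have hτ₀le : ∀ m, ‖τ₀ m‖ ≤ 4 := fun m =>
    le_of_tendsto ((tendsto_pi_nhds.1 hτ₀ m).norm) (Eventually.of_forall fun j => hτ (ψ j) m)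
  -- Step 3: the limit cell is invertible; the limit lattice `A₀ Λ` and configuration `P∞`
  have hlow₀ : ∀ v, (189 / 200 : ℝ) * ‖v‖ ≤ ‖A₀ v‖ :=
    lower_of_tendsto hA₀ (fun j v => hlow (ψ j) v)
  have hinj₀ : Function.Injective (A₀ : E3 →ₗ[ℝ] E3) := inj_of_low A₀ hlow₀
  set Ae := (LinearEquiv.ofInjectiveEndo _ hinj₀).toContinuousLinearEquiv with hAedef
  have hAe : ∀ v, Ae v = A₀ v := fun v => rfl
  set G := ZLattice.comap ℝ L Ae.symm.toLinearMap with hGdef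
  have hG' : ∀ g, g ∈ G ↔ Ae.symm g ∈ L := fun g => by
    rw [hGdef, ZLattice.comap, Submodule.mem_comap]; rfl
  have hG : ∀ g, g ∈ G ↔ ∃ z ∈ L, g = A₀ z := fun g => by
    rw [hG']
    constructor
    · intro hg
      exact ⟨Ae.symm g, hg, by rw [← hAe, ContinuousLinearEquiv.apply_symm_apply]⟩
    · rintro ⟨z, hz, rfl⟩
      rwa [← hAe, ContinuousLinearEquiv.symm_apply_apply]
  haveI : DiscreteTopology G := by rw [hGdef]; infer_instance
  haveI : IsZLattice ℝ G :=
    (inferInstance : IsZLattice ℝ (ZLattice.comap ℝ L Ae.symm.toLinearMap))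
  obtain ⟨P, -, hPp⟩ := exists_periodicConfiguration_two G τ₀
  have hP : ∀ s, s ∈ P.points ↔ ∃ m : Fin 2, ∃ z ∈ L, s = τ₀ m + A₀ z := fun s => by
    rw [hPp, Set.mem_setOf_eq]
    constructor
    · rintro ⟨m, g, hg, rfl⟩
      obtain ⟨z, hz, rfl⟩ := (hG g).1 hg
      exact ⟨m, z, hz, rfl⟩
    · rintro ⟨m, z, hz, rfl⟩
      exact ⟨m, A₀ z, (hG _).2 ⟨z, hz, rfl⟩, rfl⟩
  -- Step 4: the charts, with the identity isometry, along `ψ`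
  refine ⟨P, fun R ε hR hε N₀ => ?_⟩
  set ε' := min ε 1 with hε'def
  have hε' : 0 < ε' := lt_min hε one_pos
  have hε'ε : ε' ≤ ε := min_le_left _ _
  have hε'1 : ε' ≤ 1 := min_le_right _ _
  set K : ℝ := (R + 1 + 4) / (189 / 200) with hKdef
  have e0 : ∀ᶠ j in atTop, N₀ ≤ ψ j := hψ.tendsto_atTop.eventually_ge_atTop N₀
  have e1 : ∀ᶠ j in atTop, 1 / ((ψ j : ℝ) + 1) ≤ ε' / 2 := by
    have h1 : Tendsto (fun j => 1 / ((ψ j : ℝ) + 1)) atTop (𝓝 0) :=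
      tendsto_one_div_add_atTop_nhds_zero_nat.comp hψ.tendsto_atTop
    exact h1.eventually_le_const (by positivity)
  have e2 : ∀ᶠ j in atTop, R + 1 ≤ (ψ j : ℝ) :=
    (tendsto_natCast_atTop_atTop.comp hψ.tendsto_atTop).eventually_ge_atTop _
  have e3 : ∀ᶠ j in atTop, dist (τ (ψ j)) τ₀ ≤ ε' / 4 :=
    (tendsto_iff_dist_tendsto_zero.1 hτ₀).eventually_le_const (by positivity)
  have e4 : ∀ᶠ j in atTop, ‖A (ψ j) - A₀‖ * K ≤ ε' / 4 := by
    have h1 : Tendsto (fun j => ‖A (ψ j) - A₀‖ * K) atTop (𝓝 0) := by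
      simpa using (tendsto_iff_norm_sub_tendsto_zero.1 hA₀).mul_const K
    exact h1.eventually_le_const (by positivity)
  obtain ⟨j, hj0, hj1, hj2, hj3, hj4⟩ := (e0.and (e1.and (e2.and (e3.and e4)))).exists
  set k := ψ j with hkdef
  refine ⟨Nk k, hj0.trans (hNk k), x k, hx k, i k, LinearIsometry.id, fun s hs hsR => ?_,
    fun j' hj' => ?_⟩
  · -- every site of `P∞` in the ball is occupied
    obtain ⟨m, z, hz, rfl⟩ := (hP s).1 hs
    have hd : dist (τ₀ m + A₀ z) (τ k m + A k z) ≤ ε' / 2 := by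
      have h0 := dist_sites_le (p₁ := τ₀ m) (p₂ := τ k m) (B₁ := A₀) (B₂ := A k)
        (by norm_num : (0 : ℝ) < 189 / 200) hlow₀ z
      have h1 : ‖τ₀ m - τ k m‖ ≤ ε' / 4 := by
        rw [← dist_eq_norm, dist_comm]; exact (dist_le_pi_dist _ _ m).trans hj3
      have h2 : ‖A₀ - A k‖ * ((‖τ₀ m + A₀ z‖ + ‖τ₀ m‖) / (189 / 200)) ≤ ε' / 4 := by
        rw [norm_sub_rev]
        refine le_trans (mul_le_mul_of_nonneg_left ?_ (norm_nonneg _)) hj4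
        rw [hKdef]
        gcongr
        · linarith
        · exact hτ₀le m
      linarith
    have hs'norm : ‖τ k m + A k z‖ ≤ (k : ℝ) := by
      have h1 := norm_le_insert' (τ k m + A k z) (τ₀ m + A₀ z)
      rw [← dist_eq_norm, dist_comm] at h1
      linarith
    obtain ⟨j', hj'⟩ := hNear₂ k m z hz hs'norm
    refine ⟨j', ?_⟩
    calc dist (x k j') (x k (i k) + LinearIsometry.id (τ₀ m + A₀ z))
        ≤ dist (x k j') (x k (i k) + (τ k m + A k z)) +
            dist (x k (i k) + (τ k m + A k z)) (x k (i k) + (τ₀ m + A₀ z)) := dist_triangle _ _ _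
      _ ≤ ε' / 2 + ε' / 2 := by
          rw [dist_add_left]
          exact add_le_add (hj'.trans hj1) (by rw [dist_comm]; exact hd)
      _ ≤ ε := by linarith
  · -- every particle in the ball is close to a site of `P∞`
    have hjk : dist (x k j') (x k (i k)) ≤ (k : ℝ) := hj'.trans (by linarith)
    obtain ⟨m, z, hz, hd⟩ := hNear₁ k j' hjk
    have hd' : dist (x k j') (x k (i k) + (τ k m + A k z)) ≤ ε' / 2 := hd.trans hj1
    have hs'norm : ‖τ k m + A k z‖ ≤ R + 1 := by
      have h1 := dist_triangle (x k (i k) + (τ k m + A k z)) (x k j') (x k (i k))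
      rw [dist_self_add_left, dist_comm] at h1
      linarith
    have hd2 : dist (τ k m + A k z) (τ₀ m + A₀ z) ≤ ε' / 2 := by
      have h0 := dist_sites_le (p₁ := τ k m) (p₂ := τ₀ m) (B₁ := A k) (B₂ := A₀)
        (by norm_num : (0 : ℝ) < 189 / 200) (hlow k) z
      have h1 : ‖τ k m - τ₀ m‖ ≤ ε' / 4 := by
        rw [← dist_eq_norm]; exact (dist_le_pi_dist _ _ m).trans hj3
      have h2 : ‖A k - A₀‖ * ((‖τ k m + A k z‖ + ‖τ k m‖) / (189 / 200)) ≤ ε' / 4 := by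
        refine le_trans (mul_le_mul_of_nonneg_left ?_ (norm_nonneg _)) hj4
        rw [hKdef]
        gcongr
        exact hτ k m
      linarith
    refine ⟨τ₀ m + A₀ z, (hP _).2 ⟨m, z, hz, rfl⟩, ?_⟩
    calc dist (x k j') (x k (i k) + LinearIsometry.id (τ₀ m + A₀ z))
        ≤ dist (x k j') (x k (i k) + (τ k m + A k z)) +
            dist (x k (i k) + (τ k m + A k z)) (x k (i k) + (τ₀ m + A₀ z)) := dist_triangle _ _ _
      _ ≤ ε' / 2 + ε' / 2 := by
          rw [dist_add_left]
          exact add_le_add hd' hd2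
      _ ≤ ε := by linarith

/-- **Stub `stub_fineGrainsGivesPeriodicMin`** (line `Sketch` of crux `FineGrains`,
stmt-AtomisticToContinuum-9330; card `self-certifying-grains`, by-product (B)): fine affine-hcp
grains at every scale in all large Lennard-Jones ground states imply that the infimum of the
Lennard-Jones energy per particle over periodic configurations of `ℝ³` is attained
(`CrysPeriodicMinAttained`, item stmt-AtomisticToContinuum-0627): the diagonal limit two-lattice
of `exists_periodic_charts_of_fineGrains` is self-certifying (`stub_selfCertify`). [folklore] -/
theorem stub_fineGrainsGivesPeriodicMin :
    ExcessDecayLiouville.FineGrains → ExcessDecayLiouville.CrysPeriodicMinAttained := fun hFG => by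
  obtain ⟨P, hP⟩ := exists_periodic_charts_of_fineGrains hFG
  exact ⟨P, stub_selfCertify P hP⟩

end Summit.AtomisticToContinuum.Crystallization.Theorems.ExcessDecayLiouvilleFineGrains

end
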